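import Literature.Geometry.DiscreteGeometry.DelsarteLinearProgrammingBound

/-!
# Spherical codes, standard table: `A(8, 1/5) ≤ 35` (certified Delsarte LP bound)

Framing: lottery ticket; floor = certified bounds/negative ranges. Venture `PackingBounds`
(cell `pub-packcert`), spherical-code family, standard-angle grid row `s = 1/5` (LP-only extension row of the
cell's table; no printed comparison table for this angle), dimension 8.

Every finite set of unit vectors of `ℝ^8` with pairwise inner products `≤ 1/5` has at most `35`
elements. Proof: the linear programming bound (`Literature.Geometry.DiscreteGeometry.DelsarteLP.card_le`)
with an exact rational product-form polynomial of degree 3 (nonpositive on `[-1, 1/5]` by its shape),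
whose Gegenbauer coefficients for `S^7` (`μ = 3`) are the nonnegative rationals in the proof;
`f(1)/f_0` = 35.764706…, hence `|C| ≤ 35`. Certificate produced from the float LP optimum
(kit job j082031) by rational rounding and checked exactly by two code-disjoint verifiers (change of
basis / orthogonality) before this kernel check; data `certs/codes/code_n8_s1-5.json`
of the cell. This is the classical two-point (LP) value; three-point SDP bounds (Bachoc–Vallentin 2008,
Table 5.2) are lower where computed.

## References
* P. Delsarte, J. M. Goethals, J. J. Seidel, Geom. Dedicata 6 (1977) 363–388. [`DelsarteGoethalsSeidel1977`]
* J. H. Conway, N. J. A. Sloane, *Sphere Packings, Lattices and Groups*, Ch. 9 §3 (LP method). [`ConwaySloane1999`]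
-/

namespace Summit.Ventures.PackingBounds.SphericalCodes

open Finset Literature.Analysis.SpecialFunctions Literature.Geometry.DiscreteGeometry

/-- **`A(8, 1/5) ≤ 35`**: a finite set of unit vectors of `ℝ^8` with pairwise inner products `≤ 1/5`
has at most `35` elements — certified Delsarte LP bound, exact rational certificate of degree 3.
(Delsarte–Goethals–Seidel LP bound; certified row of the `pub-packcert` grid.) -/
theorem code_dim8_fifth_le_35 (C : Finset (EuclideanSpace ℝ (Fin 8)))
    (h1 : ∀ x ∈ C, ‖x‖ = 1) (h2 : ∀ x ∈ C, ∀ y ∈ C, x ≠ y → inner ℝ x y ≤ 1 / 5) :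
    C.card ≤ 35 := by
  refine DelsarteLP.card_le (n := 8) (μ := 3) (by norm_num) (by norm_num) 3
    (fun k => match k with
      | 0 => 238905501479 / 5000000000000 | 1 => 109467549507 / 2000000000000
      | 2 => 120513 / 4000000 | 3 => 1 / 80 | _ => 0)
    ?_ (1 / 5) ?_ 35 (by norm_num) ?_ C h1 h2
  · intro k
    split <;> norm_num
  · intro t ht1 ht2
    have key : (t + 461539 / 1000000) ^ 2 * (t - 1 / 5) ≤ 0 :=
      mul_nonpos_of_nonneg_of_nonpos (by positivity) (by linarith)
    have hsum : ∑ k ∈ range (3 + 1),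
        (fun k => match k with
      | 0 => 238905501479 / 5000000000000 | 1 => 109467549507 / 2000000000000
      | 2 => 120513 / 4000000 | 3 => 1 / 80 | _ => 0) k * gegenbauerSum (3 : ℝ) k t =
        (t + 461539 / 1000000) ^ 2 * (t - 1 / 5) := by
      simp [Finset.sum_range_succ, gegenbauerSum, gegenbauerCoeff, Finset.prod_range_succ,
        Nat.factorial]
      ring
    rw [hsum]
    exact key
  · norm_num [Finset.sum_range_succ, gegenbauerSum, gegenbauerCoeff, Finset.prod_range_succ,
      Nat.factorial]

end Summit.Ventures.PackingBounds.SphericalCodes
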